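import Literature.NumberTheory.LFunctions.WeilExplicit
import HarnessLib

/-!
# Weil positivity at the archimedean place (Yoshida 1992, Thm 1; Connes–Consani 2021)

Family `rh`, trunk T-ANT. One named fact (D-0014, `def … : Prop`, no proof):
`Literature.NumberTheory.LFunctions.weilPositivityOn_log_two_half` — Weil's quadratic functional is non-negative on smooth test
functions supported in `[-(log 2)/2, (log 2)/2]` (multiplicatively: `supp ⊆ [2^{-1/2}, 2^{1/2}]`),
the range in which no prime power enters the explicit formula ("the single archimedean place").

Sources (reground 2026-08-14, page-level).
* PRIMARY, verbatim: H. Yoshida, *On Hermitian forms attached to zeta functions*, in: Zeta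
  functions in geometry (Tokyo 1990), Adv. Stud. Pure Math. 21 (1992), 281–325
  (doi:10.2969/aspm/02110281), **Theorem 1 (p. 310)**: "Let `a = log 2/2`. We have
  `⟨φ, φ⟩ = T_Q(φ ∗ φ̃) ≥ 0` for every `φ ∈ K(a)`, where equality holds if and only if `φ = 0`."
  Here (p. 281, p. 283, p. 287) `Φ(s) = ∫ F(x) e^{(s−1/2)x} dx` (= `Literature.NumberTheory.LFunctions.weilMellin`),
  `φ̃(x) = conj φ(−x)` (= `Literature.NumberTheory.LFunctions.weilReflect`), `T_Q(F) = ∫ F(x)(e^{x/2} + e^{−x/2}) dx − (log π) F(0)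
  − Σ_p Σ_m (log p) p^{−m/2} (F(m log p) + F(−m log p)) + (1/2π) ∫ F̂(t) Re ψ(1/4 + it/2) dt`
  (= `Literature.NumberTheory.LFunctions.weilFunctional`, polar term INCLUDED, no vanishing conditions), and
  `K(a) ⊇ C(a) = {φ ∈ C_c^∞(ℝ) : supp φ ⊆ [−a, a]}` (p. 287). So the fact below is Yoshida's
  Theorem 1 restricted to `C(a) ⊆ K(a)`. (The proof in §6 is a finite matrix computation
  "verified rather easily on a computer", p. 310.) Bombieri, Rend. Lincei (9) 11 (2000) §1
  reports it: Yoshida "verifies this positivity for `t = (log 2)/2`"; Bombieri's own §12 Thm 12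
  gives positivity only for support of length `< log 2` up to an unspecified `O(1)`.
* STRENGTHENING on a subspace (NOT the statement below): A. Connes, C. Consani, *Weil positivity
  and trace formula, the archimedean place*, Selecta Math. (N.S.) 27 (2021), Paper 77
  (= arXiv:2006.13771), Thm. 1 (arXiv p. 4): for `g ∈ C_c^∞(ℝ_+^*)` with support in
  `[2^{-1/2}, 2^{1/2}]` AND Fourier transform vanishing at `i/2` and `0`,
  `W_∞(g ∗ g^*) ≥ Tr(ϑ(g) S ϑ(g)^*)` (archimedean term only, Sonin-space trace); CC2021 p. 4
  attribute the plain positivity (with vanishing at `±i/2`) to [yoshida].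
Normalisation: H21's additive variable `t = log x` (`Literature/NumberTheory/LFunctions/WeilExplicit.lean`,
Bombieri 2000 §2), so the multiplicative interval `[2^{-1/2}, 2^{1/2}]` is
`Icc (-(log 2)/2) ((log 2)/2)` and the statement is literally `Literature.WeilPositivityOn (Real.log 2 / 2)`.

Design. Stated through the accepted `Literature.NumberTheory.LFunctions.WeilPositivityOn` (junk-free `∀ g` form; the support
condition is on `g`, so `supp (g ⋆ g̃) ⊆ [-log 2, log 2]` and the prime term of `W(g ⋆ g̃)`
vanishes: no `n ≥ 2` has `log n < log 2` in the open support). Used as the hypothesis of the first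
arithmetic rung `WeilPositivityOn (Real.log 3 / 2)` (route RiemannHypothesis/WeilPos); grounds
`Summit.RiemannHypothesis.RiemannHypothesis.Theses.WeilPos.WeilposRungArch` (item = fact by `exact h`).
-/

noncomputable section

namespace Literature.NumberTheory.LFunctions

/-- **Weil positivity at the archimedean place** (H. Yoshida, Adv. Stud. Pure Math. 21 (1992),
Theorem 1, p. 310: "Let `a = log 2/2`. We have `⟨φ, φ⟩ = T_Q(φ ∗ φ̃) ≥ 0` for every
`φ ∈ K(a)`", with `K(a) ⊇ C(a) = C_c^∞` functions supported in `[−a, a]`, `T_Q` the full Weil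
functional of the explicit formula for `ζ` including the polar term): for every smooth compactly
supported `g : ℝ → ℂ` with `tsupport g ⊆ [-(log 2)/2, (log 2)/2]`, `Re W(g ⋆ g̃) ≥ 0`, i.e.
`WeilPositivityOn ((log 2)/2)` in the additive normalisation of `WeilExplicit` (which is
Yoshida's, symbol by symbol). Connes–Consani, Selecta Math. 27 (2021) Thm. 1 is a stronger
inequality on the finite-codimension subspace `ĝ(i/2) = ĝ(0) = 0` and is NOT this statement.
Grounds `Summit.RiemannHypothesis.RiemannHypothesis.Theses.WeilPos.WeilposRungArch`.
[cite: Yoshida1992, Thm. 1 (p. 310); cf. ConnesConsani2021, Thm. 1] -/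
def weilPositivityOn_log_two_half : Prop :=
  WeilPositivityOn (Real.log 2 / 2)

end Literature.NumberTheory.LFunctions

end
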